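import Summits.QuantumFields.BalabanUV.T4Continuum.Support.NE7LandauB8GaugeTransportRows
import Summits.QuantumFields.BalabanUV.T4Continuum.Spine.NE3.LandauProjectionB8
import HarnessLib

/-!
# NE7LandauB8HarmonicExtensionOfRows — (R-H8) ⟸ (T1♯) + (R-C8): the (1.38)-harmonic extension's sup row FROM an exact smooth right inverse of the nested transported
# block mean (sup `C_a`, covariant-Laplacian sup `C_a′`) AND the (1.38)-Landau correction row (sup `C_b`, DISCHARGED by F180): `C_H = C_a + C_b·C_a′`
# (file 112 of the curved (APE), F182)

Cell `pub-balaban`, rung (B)+1 sub-cell t4, lineage `b2b-balaban-t4-ne7-p1` (CRUX PROVER NE7 #1 = OWNER of row NE7), generation 84; memo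
`t4/b2b-balaban-t4-ne7-p1-g84/SCALAR-ROWS.md`.  The SIZE twin of F179 `NE7LandauB8HarmonicExtensionExists` (any extension + its (1.38)-Landau correction).
WHY.  After F180∕F181 the END rests on (KL-B) + (R-H8).  (R-H8)'s extension `h` with `bmeanIterW h = θ′`, `IsLandauB8 (D_W h)` is CANONICAL (`h = h₀ + c`, `c ∈ N(Q′(W))` the
(1.38)-Landau correction of `Z = D_W h₀`, for ANY extension `h₀`), and (R-C8) prices `c` by `C_b·‖covDiv_W D_W h₀‖_∞ = C_b·‖Δ_W h₀‖_∞`; so the SIZE of `h` is `C_a + C_b·C_a′` as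
soon as ONE extension `h₀` has sup `≤ C_a·s` and COVARIANT-LAPLACIAN sup `≤ C_a′·s` — the letter (T1♯).  With F180's `C_b ≍ M²·c_RE`, a k-uniform `C_H` needs `C_a′ ≍ 1∕M²`:
a `C¹`-smooth (squared-tent ∕ quasi-interpolant) exact right inverse of `bmeanIterW` at the curved background — pure approximation theory over row NE3's nested-mean
kinematics (`NE3NestedMeanBlockOperator`, `NE3NestedBlockMeanBridge`, `NE3SquaredTentBump`), no Green's function; built in the sequel files.
WHAT ([folklore]; 0 def, 0 sorry).  **`harmonicExtensionRow_of_smoothRightInverse`** — the END's binder `hRH` (shape of F177∕F178) with `C_H := C_a + C_b·C_a′` from the two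
displayed letters (T1♯) `hT` and (R-C8) `hRC`.
HONEST FRAMING (page 1): finite-dimensional bookkeeping; (T1♯) is a DISPLAYED HYPOTHESIS (NOT proved here); (R-C8) is F180's theorem in the END's volume currency;
nothing of Bałaban's asserted; (APE) on curved data NOT proved; NOT ONE-STEP, NOT NE7; spine 0∕9; finite T⁴ rung (B)+1 — NOT infinite volume, NOT mass gap, NOT
`BetaPertH`, NOT Clay.  Continuum YM on T⁴ ⇐ BetaPertH ∧ nine spine estimates (0/9 proved); BetaPertH ⇐ (D1) ∧ (D4) ∧ CAP+tail; G-an2-4 gates asym, D1 and NE2/3/4.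
-/

set_option autoImplicit false

open scoped BigOperators Matrix Matrix.Norms.L2Operator
open NormedSpace Finset

namespace Summit.QuantumFields.BalabanUV.T4Continuum.NE7LandauB8HarmonicExtensionOfRows

open Literature.MathematicalPhysics.QuantumFieldTheory.Balaban1983to89
open B7Prop1Explicit B7Prop2Explicit
open T4AveragingDeficitWall (IsUnitaryCfg IsSkewDir SmallField)
open T4AveragingDeficitWallBoundary (IsPeriodicCfg periodBox)
open AveragingDeficitPeriodicCounting (IsPeriodicDir)
open BlockAveragePushDirGauge (gaugeDir isPeriodicDir_gaugeDir)
open NE3CovariantCalculus (hsR hsR_add_left)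
open NE3TangentCovariantStructure (gaugeDir_add_fun)
open NE3CovariantWeitzenbock (covDiv)
open NE3CovariantBlockMean (bmeanIterW)
open NE3FrameFreeSliceW (bmeanIterW_add)
open NE7ExactCurrent (isSkewDir_gaugeDir)
open NE3.PairLandauB8 (avgKernelGauges mem_avgKernelGauges_iff covLapSite IsLandauB8)
open NE3.LandauProjectionB8 (covDiv_gaugeDir_eq_covLapSite)

noncomputable section

variable {d : ℕ} {n : Type*} [Fintype n] [DecidableEq n]

/-- **(R-H8) FROM (T1♯) + (R-C8)**: if (T1♯) every skew `N`-periodic coarse `θ′` with `‖θ′‖_∞ ≤ s` has a skew `(N·L^{j+1})`-periodic extension `h₀` with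
`bmeanIterW L (j+1) W h₀ = θ′`, `‖h₀‖_∞ ≤ C_a·s`, `‖Δ_W h₀‖_∞ ≤ C_a′·s`, and (R-C8) every skew periodic `Z` with `‖covDiv_W Z‖_∞ ≤ D′` has a correction `c ∈ N(Q′(W))` with
`Z + D_W c` (1.38)-Landau and `‖c‖_∞ ≤ C_b·D′`, then every such `θ′` has a skew periodic `h` with `bmeanIterW L (j+1) W h = θ′`, `IsLandauB8 (D_W h)` and
`‖h‖_∞ ≤ (C_a + C_b·C_a′)·s` — the END's `hRH` with `C_H = C_a + C_b·C_a′`. [folklore] -/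
theorem harmonicExtensionRow_of_smoothRightInverse {L N : ℕ} (j : ℕ) {W : Site d → Fin d → (Matrix n n ℂ)ˣ} (hWu : IsUnitaryCfg W)
    (hWP : IsPeriodicCfg W ((N * L ^ (j + 1) : ℕ) : ℤ)) {Ca Ca' Cb : ℝ}
    (hT : ∀ θ' : Site d → Matrix n n ℂ, (∀ z, θ' z ∈ skewAdjoint (Matrix n n ℂ)) → (∀ (z : Site d) (i : Fin d), θ' (z + (N : ℤ) • e i) = θ' z) →
      ∀ s : ℝ, (∀ z, ‖θ' z‖ ≤ s) →
      ∃ h₀ : Site d → Matrix n n ℂ, (∀ y, h₀ y ∈ skewAdjoint (Matrix n n ℂ)) ∧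
        (∀ (y : Site d) (i : Fin d), h₀ (y + ((N * L ^ (j + 1) : ℕ) : ℤ) • e i) = h₀ y) ∧
        bmeanIterW L (j + 1) W h₀ = θ' ∧ (∀ y, ‖h₀ y‖ ≤ Ca * s) ∧ (∀ y, ‖covLapSite W h₀ y‖ ≤ Ca' * s))
    (hRC : ∀ Z : Site d → Fin d → Matrix n n ℂ, IsSkewDir Z → IsPeriodicDir Z ((N * L ^ (j + 1) : ℕ) : ℤ) →
      ∀ D' : ℝ, (∀ y, ‖covDiv W Z y‖ ≤ D') →
      ∃ c ∈ avgKernelGauges (d := d) (n := n) L N (j + 1) W,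
        IsLandauB8 (d := d) L N (j + 1) W (fun y κ => Z y κ + gaugeDir W c y κ) ∧
        ∀ y, ‖c y‖ ≤ Cb * D') :
    ∀ θ' : Site d → Matrix n n ℂ, (∀ z, θ' z ∈ skewAdjoint (Matrix n n ℂ)) → (∀ (z : Site d) (i : Fin d), θ' (z + (N : ℤ) • e i) = θ' z) →
      ∀ s : ℝ, (∀ z, ‖θ' z‖ ≤ s) →
      ∃ h : Site d → Matrix n n ℂ, (∀ y, h y ∈ skewAdjoint (Matrix n n ℂ)) ∧
        (∀ (y : Site d) (i : Fin d), h (y + ((N * L ^ (j + 1) : ℕ) : ℤ) • e i) = h y) ∧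
        bmeanIterW L (j + 1) W h = θ' ∧ IsLandauB8 (d := d) L N (j + 1) W (gaugeDir W h) ∧ (∀ y, ‖h y‖ ≤ (Ca + Cb * Ca') * s) := by
  intro θ' hθs hθP s hθb
  -- (T1♯): a smooth exact extension
  obtain ⟨h₀, hh₀s, hh₀P, hh₀m, hh₀b, hh₀L⟩ := hT θ' hθs hθP s hθb
  -- (R-C8) on `Z = D_W h₀`, whose covariant divergence is `Δ_W h₀`
  have hZs : IsSkewDir (gaugeDir W h₀) := isSkewDir_gaugeDir hWu hh₀s
  have hZP : IsPeriodicDir (gaugeDir W h₀) ((N * L ^ (j + 1) : ℕ) : ℤ) := isPeriodicDir_gaugeDir hWP hh₀P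
  have hD : ∀ y, ‖covDiv W (gaugeDir W h₀) y‖ ≤ Ca' * s := fun y => by rw [covDiv_gaugeDir_eq_covLapSite]; exact hh₀L y
  obtain ⟨c, hc, hcL, hcb⟩ := hRC (gaugeDir W h₀) hZs hZP (Ca' * s) hD
  obtain ⟨hcs, hcP, hcm⟩ := mem_avgKernelGauges_iff.mp hc
  refine ⟨fun y => h₀ y + c y, fun y => (skewAdjoint (Matrix n n ℂ)).add_mem (hh₀s y) (hcs y),
    fun y i => by simp only [hh₀P y i, hcP y i], ?_, fun nu hnu => ?_, fun y => ?_⟩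
  · have h1 : (fun y => h₀ y + c y) = h₀ + c := rfl
    rw [h1, bmeanIterW_add, hh₀m, hcm, add_zero]
  · have h := hcL nu hnu
    calc ∑ y ∈ periodBox (d := d) (N * L ^ (j + 1)), ∑ κ : Fin d, hsR (gaugeDir W (fun y' => h₀ y' + c y') y κ) (gaugeDir W (covLapSite W nu) y κ)
        = ∑ y ∈ periodBox (d := d) (N * L ^ (j + 1)), ∑ κ : Fin d, hsR (gaugeDir W h₀ y κ + gaugeDir W c y κ) (gaugeDir W (covLapSite W nu) y κ) := by
          refine Finset.sum_congr rfl fun y _ => Finset.sum_congr rfl fun κ _ => by rw [gaugeDir_add_fun]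
      _ = 0 := h
  · calc ‖h₀ y + c y‖ ≤ ‖h₀ y‖ + ‖c y‖ := norm_add_le _ _
      _ ≤ Ca * s + Cb * (Ca' * s) := add_le_add (hh₀b y) (hcb y)
      _ = (Ca + Cb * Ca') * s := by ring

end

end Summit.QuantumFields.BalabanUV.T4Continuum.NE7LandauB8HarmonicExtensionOfRows
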